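import Summits.QuantumAdvantage.QuantumAdvantage.Theorems.RingFrameRingToElimOfLDMA
import Summits.QuantumAdvantage.QuantumAdvantage.Theorems.RingFrameRingToElimStubs
import Summits.QuantumAdvantage.AdviceFreeQNC0.LDMATransfer
import HarnessLib

/-!
# Route RingFrame, crux α `RingToElim` (stmt-QuantumAdvantage-19119): the crux from LOW-DEGREE ERROR
# PATTERNS (`LDRAgg`) alone — line product2's composition in the kernel

Planner qa-qnc0-p1's post-PLDAMS cut of line `product` (TARGET §20, `Sketch8`, skeleton
`line/line-product2.lean`: `stub_pldams` / `stub_ldr` / `stub_transfer`) has two of its three stubs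
proved in the cell topic (`LDMATransfer.lean`, p447603: `pldamsBool_sqrt`,
`ldmaWith_of_pldams_of_ldrAgg`, hence `ldmaPolylog_of_ldrAgg`).  Composing with the registered
line `product` (`ringToElim_of_stub_LDMA`, p446959 — all stubs but `stub_LDMA` proved) gives the
route crux `RingToElim` BY NAME from the single remaining statement

  `stub_ldr : ∀ c > 0, ∃ K > 0, LDRAgg K (fun n => ⌊c * √n⌋₊)`

(low-degree error patterns with column degree `⌊c√L⌋`, class-aggregate factor `K`), and with the
route's closed items the rung leaf `AdviceFreeQNC0`.  So in the kernel:
`LDRAgg(K, c√·) ⟹ LDMAPolylog ⟹ ProductHardPolylog ⟹ CrossTeamHardPolylog ⟹ RingHardU ⟹ RingHard 2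
⟹ AdviceFreeQNC0`.

WHAT THIS IS NOT: not a proof of the crux — `LDRAgg` (stub_ldr) is OPEN (possibly false); no
separation is claimed.
-/

-- the sub-problem namespace `Summit.QuantumAdvantage.QuantumAdvantage` repeats the summit name by design (D-0017)
set_option linter.dupNamespace false

namespace Summit.QuantumAdvantage.QuantumAdvantage.Theorems.RingToElim

open Summit.QuantumAdvantage.AdviceFreeQNC0

/-- **Crux α from `LDRAgg`**: low-degree error patterns with column degree `⌊c√L⌋` (every `c > 0`)
give the route crux `RingToElim` (via `ldmaPolylog_of_ldrAgg` and the four proved stubs of line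
`product`). -/
theorem ringToElim_of_ldrAgg
    (h : ∀ c : ℝ, 0 < c → ∃ K : ℝ, 0 < K ∧ LDRAgg K (fun n => ⌊c * Real.sqrt n⌋₊)) :
    Summit.QuantumAdvantage.QuantumAdvantage.Theses.RingFrame.RingToElim :=
  ringToElim_of_stub_LDMA (ldmaPolylog_of_ldrAgg h)

/-- **The rung leaf from `LDRAgg`**: with the route's closed items (β side and the bridge), the
whole route `RingFrame` reduces to `stub_ldr`. -/
theorem adviceFreeQNC0_of_ldrAgg
    (h : ∀ c : ℝ, 0 < c → ∃ K : ℝ, 0 < K ∧ LDRAgg K (fun n => ⌊c * Real.sqrt n⌋₊)) :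
    Summit.QuantumAdvantage.AdviceFreeQNC0.AdviceFreeQNC0 :=
  Summit.QuantumAdvantage.QuantumAdvantage.Theorems.adviceFreeQNC0_of_ldma (ldmaPolylog_of_ldrAgg h)

end Summit.QuantumAdvantage.QuantumAdvantage.Theorems.RingToElim
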